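import Literature.NumberTheory.EllipticCurves.Rank1Residual.X11aPrintCertificates.Schema
import Literature.NumberTheory.EllipticCurves.Rank1Residual.X11
import Literature.NumberTheory.EllipticCurves.AnalyticRankOrderProofs
import HarnessLib

/-!
# Class X11a — PRINT-route certificate records: what a record CLAIMS about its curve, and `BSD(E,p)` from the claim on the unit sub-cell

Cell `bsd-print-x11a` (D-0131 (2) print tier), typer seat ty3. Companion of `Schema.lean` (the record
FORMAT and its in-kernel recheck) and of the display files `Records*.lean`. This file says, in the
tree's vocabulary (`Literature/…/Rank1Residual/Predicates.lean`), what a record MEANS for its curve —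
`Record.Claim`, a `Prop` to be taken as an explicit hypothesis `(h : r.Claim)`, D-0014 style: the
conjunction of the per-pair HYPOTHESIS CERTIFICATES the print route's discharges consume at a pair
`(E, p)` of the residual class X11a (`r_an = 0`, `p` odd, `p ‖ N`, `E[p]` irreducible, no (ram)
prime): analytic rank `0`, multiplicative reduction at `p`, `E[p]` irreducible, `¬ram(p)`, surjectivity
of `ρ̄_{E,p}` when the record certifies it (`image = "surj"`, with a valuation or Serre source —
`Schema.lean`), the split/non-split type, Miller's `#Ш_an = r.shaAn`, `#E(ℚ)_tors`, `∏ c_q` — and proves: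

* `Record.classX11a_of_claim` — the claim gives the five conjuncts of the tree's
  `Summit.BirchSwinnertonDyer.Rank1Residual.ClassX11a W p` (`Partition/Rows.lean`:
  `W.analyticRank = 0 ∧ p ≠ 2 ∧ Mult W p ∧ Irr W p ∧ ¬ Ram W p`), stated here as that literal
  conjunction (Literature does not import Summits; the Summits side reads it by `id`);
* (the Literature class `ClassX11 W p`, clause `¬ram`, is read off inline as `⟨Mult, Irr, Or.inl ¬Ram⟩` — no
  separate lemma: the gate's dedup rule identifies it with `X11RankOneCertificates.Record.classX11_of_claim`);
* `Record.bsdp_of_claim_of_surj_unit` — **the unit sub-cell is closed IN PRINT, per record**: for a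
  certified record with `image = "surj"` and `p ∤ #Ш_an` (sub-cell `Pub` at `p ≥ 5`, and the `p = 3`
  unit sub-population of `Three`), `BSD(E,p)` for the record's curve follows from the claim and three
  PUBLISHED named facts — Wuthrich, Doc. Math. 19 (2014) Prop. 21 (`hWu : sha_dvd_analyticSha`: at an
  odd non-additive `p` with surjective `ρ̄_{E,p}`, `#Ш ∣ C·#Ш_an` with `p ∤ C`), Gross–Zagier–Kolyvagin
  (`hGZK`), modularity (`hmod : hasEntireLFunction_rat`, to read `L(E,1) ≠ 0` off `r_an = 0`) —
  through the tree theorem `Rank1Residual.bsdp_of_classX11_rankZero_surj_of_shaAn_unit` (x11a gen 1,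
  `Rank1Residual/X11.lean`); `Record.bsdp_of_claim_of_pub` is the `cell = "Pub"` form and
  `bsdp_of_certified_of_claims_of_pub` the list form used by the display files' docstrings;
* the leaf sub-cells are NOT closed here: on `LeafSurj` (`p ∣ #Ш_an`) the record's `mu` witness is the
  per-pair input `μ^an(E,p) = 0` of the end state `X11a/EndState.lean` (12 further named facts, chain
  `X11a/ChainAnyLevel.lean`, Summits side), on `LeafNonSurj` the input is Mazur's main conjecture at the
  pair (`X2.MazurMainConjectureAt`, typed), on `Three` with `3 ∣ #Ш_an` the input is `TargetThree` —
  this file records those facts in prose only (no Summits import is possible), and asserts nothing there.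

Trust base of `BSDp r.curve r.p` for a certified unit record: the three named facts, the record's
`Claim` (engines T = Cremona's tables, K = the kernel recheck of `Schema.lean`, P = PARI/GP, S =
Sage/eclib — the kit jobs named in each display file), and global minimality of Cremona's model
(instance hypothesis). Per pair; NOT a class theorem; no label of the partition moves by this file.

References: C. Wuthrich, Doc. Math. 19 (2014) Prop. 21 [Wuthrich2014]; R. L. Miller, LMS J. Comput.
Math. 14 (2011) Def. 1.1 [Miller2011LMS]; B. Gross, D. Zagier, Invent. Math. 84 (1986) / V. A.
Kolyvagin (1990) [Kolyvagin1990]; C. Breuil, B. Conrad, F. Diamond, R. Taylor, JAMS 14 (2001) Thm. A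
[BreuilConradDiamondTaylor2001]; J. E. Cremona, the elliptic curve database [Cremona2006]; tree files
`Rank1Residual/X11.lean`, `Summits/…/X11a/{Cells,EndState}.lean`.
-/

set_option autoImplicit false

noncomputable section

open scoped Classical

open WeierstrassCurve Literature.NumberTheory.EllipticCurves
  Literature.NumberTheory.EllipticCurves.Rank1Residual
  Literature.NumberTheory.EllipticCurves.Wuthrich2014

namespace Literature.NumberTheory.EllipticCurves.Rank1Residual.X11aPrintCertificates

namespace Record

/-- The Weierstrass equation over `ℚ` with the record's a-invariants (junk: the zero equation when
`ainvs` does not have five entries — excluded by `Record.check`). For the cell's records this is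
Cremona's reduced global minimal model of the curve `label`. [cite: Cremona2006, §2 (a-invariants of the reduced minimal model)] -/
def curve (r : Record) : WeierstrassCurve ℚ :=
  match r.ainvs with
  | [a₁, a₂, a₃, a₄, a₆] => ⟨a₁, a₂, a₃, a₄, a₆⟩
  | _ => ⟨0, 0, 0, 0, 0⟩

/-- **What a certificate record CLAIMS about its curve** `W = r.curve` (for the record's own model,
assumed globally minimal — Cremona's reduced minimal model): analytic rank `0`; multiplicative
reduction at `p`; `E[p]` irreducible; NO multiplicative prime `q ≠ p` with `p ∤ v_q(Δ_min)` (`¬ram`);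
`ρ̄_{E,p}` surjective if the record certifies a surjective image; split resp. non-split type as
recorded; Miller's `#Ш_an = r.shaAn`; `#E(ℚ)_tors = r.torsion`; `∏_q c_q = r.tamagawa`. Each
conjunct is the OUTPUT of the engines named in `r.engines` and, for the Galois / reduction conjuncts,
of the kernel recheck of `Schema.lean` read through the Summits-side bridges. A `Prop` to be ASSUMED,
`(h : r.Claim)`; nothing in this file proves it. [cite: Cremona2006, §3 (the tabulated invariants)]
[cite: Miller2011LMS, Def. 1.1 (#Ш_an)] -/
def Claim (r : Record) : Prop :=
  ∀ [Fact r.p.Prime] [r.curve.IsElliptic] [r.curve.IsGloballyMinimal],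
    r.curve.analyticRank = 0 ∧ Mult r.curve r.p ∧ Irr r.curve r.p ∧ ¬ Ram r.curve r.p ∧
    (r.image = "surj" → Surj r.curve r.p) ∧
    (r.split = true → r.curve.HasSplitMultiplicativeReductionAtPrime r.p) ∧
    (r.split = false → ¬ r.curve.HasSplitMultiplicativeReductionAtPrime r.p) ∧
    _root_.Literature.NumberTheory.EllipticCurves.shaAn r.curve = ((r.shaAn : ℚ) : ℂ) ∧
    r.curve.torsionOrder = r.torsion ∧ r.curve.tamagawaProduct = r.tamagawa

end Record

/-- The claims of a list of records: every record's `Claim`. [cite: Cremona2006, §3 (database entries)] -/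
def Claims (rs : List Record) : Prop := ∀ r ∈ rs, r.Claim

/-! ### From the claim to the class predicates -/

section Consumers

variable (r : Record) [Fact r.p.Prime] [r.curve.IsElliptic] [r.curve.IsGloballyMinimal]

/-- **The record's pair lies in X11a**: the five conjuncts of the tree's
`Summit.BirchSwinnertonDyer.Rank1Residual.ClassX11a r.curve r.p` (RESIDUAL-CASES §a.2 v5 row X11a:
`r_an = 0 ∧ p ≠ 2 ∧ mult(p) ∧ irr(p) ∧ ¬ram(p)`), from a passing recheck (`p` odd) and the claim.
[cite: Skinner2016PacificMC, Thm. C (the complement of hypothesis (ii) = (ram) inside rank 0, p ≥ 3, mult, irr)] -/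
theorem Record.classX11a_of_claim (hc : r.check = true) (h : r.Claim) :
    r.curve.analyticRank = 0 ∧ r.p ≠ 2 ∧ Mult r.curve r.p ∧ Irr r.curve r.p ∧ ¬ Ram r.curve r.p := by
  obtain ⟨hran, hmult, hirr, hnram, -⟩ := h
  exact ⟨hran, r.p_ne_two_of_check hc, hmult, hirr, hnram⟩

/-! ### The unit sub-cell: `BSD(E,p)` from the claim and the published facts -/

/-- One unfolding of the fuelled valuation of `Schema.lean`: a zero valuation with fuel left means no
division step was possible. [folklore] -/
private theorem natValAux_succ_eq_zero {fuel q n : ℕ}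
    (h : X11RankOneCertificates.natValAux (fuel + 1) q n = 0) : q < 2 ∨ n = 0 ∨ n % q ≠ 0 := by
  rw [X11RankOneCertificates.natValAux.eq_2] at h
  by_cases hc : q < 2 ∨ n = 0 ∨ n % q ≠ 0
  · exact hc
  · rw [if_neg hc] at h
    exact absurd h (Nat.succ_ne_zero _)

omit [Fact r.p.Prime] [r.curve.IsElliptic] [r.curve.IsGloballyMinimal] in
/-- `p ∤ #Ш_an` for a certified record with `v_p(#Ш_an) = 0` (the DERIVED `ordpShaAn`), hence
`padicValRat p #Ш_an = 0` — the unit hypothesis of Wuthrich's route in Miller's currency.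
[cite: Wuthrich2014, Prop. 21 (p. 400)] [cite: Miller2011LMS, Def. 1.1] -/
theorem Record.padicValRat_shaAn_eq_zero (hc : r.check = true) (hord : r.ordpShaAn = 0) :
    padicValRat r.p (r.shaAn : ℚ) = 0 := by
  have hpos := (r.shaAn_pos_of_check hc).1
  have hp := (r.three_le_of_check hc).1
  have hnd : ¬ r.p ∣ r.shaAn := by
    intro hd
    have hmod : r.shaAn % r.p = 0 := Nat.mod_eq_zero_of_dvd hd
    unfold Record.ordpShaAn X11RankOneCertificates.natVal at hord
    rcases natValAux_succ_eq_zero (fuel := 199) hord with h1 | h2 | h3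
    · omega
    · omega
    · exact h3 hmod
  rw [padicValRat.of_nat]
  exact_mod_cast padicValNat.eq_zero_of_not_dvd hnd

/-- **Unit sub-cell, per record: `BSD(E,p)` for the record's curve** from the claim, a passing recheck
with a CERTIFIED surjective image (`image = "surj"`) and `v_p(#Ш_an) = 0`, and the PUBLISHED facts:
Wuthrich 2014 Prop. 21 (`hWu`; a multiplicative `p` is not additive, `ρ̄_{E,p}` onto ⇒ `ord_p #Ш ≤
ord_p #Ш_an = 0`), Gross–Zagier–Kolyvagin (`hGZK`; rank `0`, `Ш` finite) and modularity (`hmod`;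
`r_an = 0 ⇒ L(E,1) ≠ 0`), through `Rank1Residual.bsdp_of_classX11_rankZero_surj_of_shaAn_unit`. Covers
the sub-cell `Pub` (`p ≥ 5`) and the `p = 3` unit sub-population. Per pair; not a class theorem.
[cite: Wuthrich2014, Prop. 21 (p. 400)] [cite: Miller2011LMS, §1 and Def. 1.1] -/
theorem Record.bsdp_of_claim_of_surj_unit (hWu : sha_dvd_analyticSha)
    (hGZK : rank_eq_analyticRank_of_analyticRank_le_one) (hmod : hasEntireLFunction_rat)
    (hc : r.check = true) (himg : r.image = "surj") (hord : r.ordpShaAn = 0) (h : r.Claim) :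
    BSDp r.curve r.p := by
  obtain ⟨hran, hmult, hirr, hnram, hsurj, -, -, hsha, -, -⟩ := h
  have hX : ClassX11 r.curve r.p := ⟨hmult, hirr, Or.inl hnram⟩
  have hL : r.curve.entireLFunction 1 ≠ 0 :=
    (r.curve.analyticRank_eq_zero_iff_holds (hmod r.curve)).mp hran
  exact bsdp_of_classX11_rankZero_surj_of_shaAn_unit (W := r.curve) (p := r.p) hWu hGZK
    (r.p_ne_two_of_check hc) hX hL (hsurj himg) ⟨r.shaAn, hsha, r.padicValRat_shaAn_eq_zero hc hord⟩

/-- **Sub-cell `Pub` (`p ≥ 5`, surjective, `p ∤ #Ш_an`): `BSD(E,p)` for the record's curve** — the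
`cell = "Pub"` form of `bsdp_of_claim_of_surj_unit` (the recheck pins `image = "surj"` and
`v_p(#Ш_an) = 0` on that sub-cell). This is `X11a/Cells.lean`'s `targetPub_of_published`, record by
record. [cite: Wuthrich2014, Prop. 21 (p. 400)] [cite: Miller2011LMS, §1 and Def. 1.1] -/
theorem Record.bsdp_of_claim_of_pub (hWu : sha_dvd_analyticSha)
    (hGZK : rank_eq_analyticRank_of_analyticRank_le_one) (hmod : hasEntireLFunction_rat)
    (hc : r.check = true) (hcell : r.cell = "Pub") (h : r.Claim) : BSDp r.curve r.p := by
  obtain ⟨-, himg, hord⟩ := r.pub_data_of_check hc hcell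
  exact r.bsdp_of_claim_of_surj_unit hWu hGZK hmod hc himg hord h

end Consumers

/-- **List form**: for a `Certified` list of records whose claims hold, `BSD(E,p)` holds for every
listed pair filed under `Pub` (for the record's model, assumed globally minimal). The shape cited by
the `RecordsPub*.lean` display files. [cite: Wuthrich2014, Prop. 21 (p. 400)] [cite: Miller2011LMS, Def. 1.1] -/
theorem bsdp_of_certified_of_claims_of_pub (hWu : sha_dvd_analyticSha)
    (hGZK : rank_eq_analyticRank_of_analyticRank_le_one) (hmod : hasEntireLFunction_rat)
    {rs : List Record} (hC : Certified rs) (hcl : Claims rs) (r : Record) (hr : r ∈ rs)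
    (hcell : r.cell = "Pub") [Fact r.p.Prime] [r.curve.IsElliptic] [r.curve.IsGloballyMinimal] :
    BSDp r.curve r.p :=
  r.bsdp_of_claim_of_pub hWu hGZK hmod (hC.check_of_mem hr) hcell (hcl r hr)

end Literature.NumberTheory.EllipticCurves.Rank1Residual.X11aPrintCertificates

end
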